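import Mathlib
import HarnessLib
import Summits.HubbardSuperconductivity.HubbardSuperconductivity.Theorems.KLProgrammeKLRegimeSplitPhValueModuli

/-!
# Route `KLProgramme` — ENGINE (stmt-HubbardSuperconductivity-20437 `KLRegimeEngineV17F2`), row (c) binder #8 (★ v19 `hexLadMV`), the direct p-h row `RP` IN THE ROWS DOOR'S LITERAL SHAPE:
# the partner sum `Σ_{p′}[ω-index(p′) = ω-index(p) ∧ p′ = p + x − y]` COLLAPSES to the single partner `p⁺ = (p.1, p.2 + x − y)`; at the diagonal `y = x` the row is TWICE the
# object of O6c/O6e, hence `≤ 2·(rotation × ‖Σ_σV₀ σ‖ + 2¹⁰·15367·δ)` — brick O6f, plumbing for `klmd_defect_le_rows_family`'s hypothesis `hP`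
# (cell gate-hubbard-kl, seat hubbard-kl-k3c2-p2 g32, technique «thermal-bar induction n ≤ nScales β + 1 with EngineBoundsAtV4S sums»)

WHY.  The rows door (`klmd_defect_le_rows_family`, …PairTransferMemberDefectRowsFamily) asks for `RP` as a bound on
`‖Σ_p Σ_σ Σ_{p′} [matsubaraInt p′.1 + matsubaraInt ω₀ = matsubaraInt p.1 + matsubaraInt ω₀ ∧ p′.2 = p.2 + x − y] · ((Φĝ)(p)(Ẇĝ)(p′) + (Ẇĝ)(p)(Φĝ)(p′)) · F(p,σ,p′)‖`
(`F` = the product of the two 4-point kernels with legs at `p, p′` and the pinned pair).  The constraint fixes `p′` uniquely (`matsubaraInt` is injective): the triple sum is a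
double sum over `(p, σ)` with partner `p⁺ = (p.1, p.2 + x − y)` (`klph_partner_sum_collapse`, `klph_directRow_eq`); at the diagonal `y = x`, `p⁺ = p` and the two bubble
orderings coincide, so the row is `2·Σ_pΣ_σ(Ẇ_tβL²ĝ_p)(Φ_jβL²ĝ_p)·F(p,σ,p)` (`klph_directRow_diag_eq`) — exactly twice the object of the rotation lemma O6c
(`klph_phValue_row_le`) and of the moduli split O6e (`klph_phValue_row_le_of_moduli`).  Hence **`klph_directRow_diag_le_of_moduli`**: in the born normalisation
`(Λₙ−Λₙ₊₁)((βL²)³)⁻¹`, the diagonal direct row is `≤ 2·((Λₙ−Λₙ₊₁)·‖Σ_σ V₀ σ‖·𝔅₆_b(Λ(t)) + 2¹⁰·15367·δ)` for any `V₀` with `‖F(p,σ,p) − V₀ σ‖ ≤ δ` on the hard shell.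
Pure finite-sum algebra + composition; no definitions; nothing asserts (c), K3 or superconductivity.  [cite: BenfattoGiulianiMastropietro2006, §2.4–§2.5]
-/

noncomputable section

namespace Summit.HubbardSuperconductivity.HubbardSuperconductivity.Theorems.KLRegimeSplit

set_option linter.dupNamespace false -- summit = problem name (single-conjunct summit), D-0017

open Real Set Finset Literature.MathematicalPhysics.QuantumLattice
open Literature.Probability.LatticeModels hiding torusSupNorm
open Literature.MathematicalPhysics.QuantumLattice.BandSectorCounting
open Summit.HubbardSuperconductivity.HubbardSuperconductivity.Theorems.TwoPointAssembly
open Summit.HubbardSuperconductivity.HubbardSuperconductivity.Theorems.KLProgrammeLegKernels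
open Summit.HubbardSuperconductivity.HubbardSuperconductivity.Theorems.KLRegimeWick
open Summit.HubbardSuperconductivity.HubbardSuperconductivity.Theorems.EngineV8
open Summit.HubbardSuperconductivity.HubbardSuperconductivity.Theorems.DispersionFlow
open Summit.HubbardSuperconductivity.HubbardSuperconductivity.Theorems.PerturbedFermiCurve

variable {L M : ℕ} [NeZero L] [NeZero M]

/-! ## §1 The partner sum collapses -/

omit [NeZero M] in
/-- **The partner constraint fixes `p′`**: for any `f`, integer `c` and torus sites `x y`,
`Σ_{p′} [matsubaraInt p′.1 + c = matsubaraInt p.1 + c ∧ p′.2 = p.2 + x − y]·f p′ = f (p.1, p.2 + x − y)` (`matsubaraInt` is injective). -/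
theorem klph_partner_sum_collapse (f : FreqMomentum L M → ℂ) (p : FreqMomentum L M) (c : ℤ) (x y : TorusSite 2 L) :
    (∑ p' : FreqMomentum L M, if matsubaraInt M p'.1 + c = matsubaraInt M p.1 + c ∧ p'.2 = p.2 + x - y then f p' else 0) = f (p.1, p.2 + x - y) := by
  have hiff : ∀ p' : FreqMomentum L M,
      (matsubaraInt M p'.1 + c = matsubaraInt M p.1 + c ∧ p'.2 = p.2 + x - y) ↔ p' = (p.1, p.2 + x - y) := by
    intro p'
    constructor
    · rintro ⟨h1, h2⟩
      have h1' : p'.1 = p.1 := matsubaraInt_injective M (add_right_cancel h1)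
      exact Prod.ext h1' h2
    · rintro rfl
      exact ⟨rfl, rfl⟩
  simp_rw [hiff]
  rw [Finset.sum_ite_eq']
  simp

omit [NeZero M] in
/-- **The direct p-h row, collapsed**: with `p⁺ := (p.1, p.2 + x − y)`,
`Σ_pΣ_σΣ_{p′}[…]·((Φĝ)(p)(Ẇĝ)(p′) + (Ẇĝ)(p)(Φĝ)(p′))·F p σ p′ = Σ_pΣ_σ ((Φĝ)(p)(Ẇĝ)(p⁺) + (Ẇĝ)(p)(Φĝ)(p⁺))·F p σ p⁺`. -/
theorem klph_directRow_eq (β μ : ℝ) (K : TrigPolyC4v) (Φw Wdw : FreqMomentum L M → ℝ) (F : FreqMomentum L M → Fin 2 → FreqMomentum L M → ℂ)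
    (c : ℤ) (x y : TorusSite 2 L) :
    (∑ p : FreqMomentum L M, ∑ σ : Fin 2, ∑ p' : FreqMomentum L M,
        if matsubaraInt M p'.1 + c = matsubaraInt M p.1 + c ∧ p'.2 = p.2 + x - y then
          ((((Φw p : ℝ) : ℂ) * (((β * (L : ℝ) ^ 2 : ℝ) : ℂ) * propCT L M β μ K p)) * (((Wdw p' : ℝ) : ℂ) * (((β * (L : ℝ) ^ 2 : ℝ) : ℂ) * propCT L M β μ K p')) +
            (((Wdw p : ℝ) : ℂ) * (((β * (L : ℝ) ^ 2 : ℝ) : ℂ) * propCT L M β μ K p)) * (((Φw p' : ℝ) : ℂ) * (((β * (L : ℝ) ^ 2 : ℝ) : ℂ) * propCT L M β μ K p'))) *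
            F p σ p'
        else 0) =
      ∑ p : FreqMomentum L M, ∑ σ : Fin 2,
        ((((Φw p : ℝ) : ℂ) * (((β * (L : ℝ) ^ 2 : ℝ) : ℂ) * propCT L M β μ K p)) *
              (((Wdw (p.1, p.2 + x - y) : ℝ) : ℂ) * (((β * (L : ℝ) ^ 2 : ℝ) : ℂ) * propCT L M β μ K (p.1, p.2 + x - y))) +
            (((Wdw p : ℝ) : ℂ) * (((β * (L : ℝ) ^ 2 : ℝ) : ℂ) * propCT L M β μ K p)) *
              (((Φw (p.1, p.2 + x - y) : ℝ) : ℂ) * (((β * (L : ℝ) ^ 2 : ℝ) : ℂ) * propCT L M β μ K (p.1, p.2 + x - y)))) *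
          F p σ (p.1, p.2 + x - y) := by
  refine sum_congr rfl fun p _ => sum_congr rfl fun σ _ => ?_
  exact klph_partner_sum_collapse (fun p' => ((((Φw p : ℝ) : ℂ) * (((β * (L : ℝ) ^ 2 : ℝ) : ℂ) * propCT L M β μ K p)) *
      (((Wdw p' : ℝ) : ℂ) * (((β * (L : ℝ) ^ 2 : ℝ) : ℂ) * propCT L M β μ K p')) +
    (((Wdw p : ℝ) : ℂ) * (((β * (L : ℝ) ^ 2 : ℝ) : ℂ) * propCT L M β μ K p)) * (((Φw p' : ℝ) : ℂ) * (((β * (L : ℝ) ^ 2 : ℝ) : ℂ) * propCT L M β μ K p'))) *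
    F p σ p') p c x y

omit [NeZero M] in
/-- **At the diagonal `y = x` the direct row is TWICE the born line pair**:
`Σ_pΣ_σΣ_{p′}[…, p′.2 = p.2 + x − x]·((Φĝ)(p)(Ẇĝ)(p′) + (Ẇĝ)(p)(Φĝ)(p′))·F p σ p′ = 2·Σ_pΣ_σ (Ẇĝ)(p)(Φĝ)(p)·F p σ p`. -/
theorem klph_directRow_diag_eq (β μ : ℝ) (K : TrigPolyC4v) (Φw Wdw : FreqMomentum L M → ℝ) (F : FreqMomentum L M → Fin 2 → FreqMomentum L M → ℂ)
    (c : ℤ) (x : TorusSite 2 L) :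
    (∑ p : FreqMomentum L M, ∑ σ : Fin 2, ∑ p' : FreqMomentum L M,
        if matsubaraInt M p'.1 + c = matsubaraInt M p.1 + c ∧ p'.2 = p.2 + x - x then
          ((((Φw p : ℝ) : ℂ) * (((β * (L : ℝ) ^ 2 : ℝ) : ℂ) * propCT L M β μ K p)) * (((Wdw p' : ℝ) : ℂ) * (((β * (L : ℝ) ^ 2 : ℝ) : ℂ) * propCT L M β μ K p')) +
            (((Wdw p : ℝ) : ℂ) * (((β * (L : ℝ) ^ 2 : ℝ) : ℂ) * propCT L M β μ K p)) * (((Φw p' : ℝ) : ℂ) * (((β * (L : ℝ) ^ 2 : ℝ) : ℂ) * propCT L M β μ K p'))) *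
            F p σ p'
        else 0) =
      2 * ∑ p : FreqMomentum L M, ∑ σ : Fin 2,
        ((((Wdw p : ℝ) : ℂ) * (((β * (L : ℝ) ^ 2 : ℝ) : ℂ) * propCT L M β μ K p)) * (((Φw p : ℝ) : ℂ) * (((β * (L : ℝ) ^ 2 : ℝ) : ℂ) * propCT L M β μ K p))) *
          F p σ p := by
  rw [klph_directRow_eq β μ K Φw Wdw F c x x, mul_sum]
  refine sum_congr rfl fun p _ => ?_
  rw [mul_sum]
  refine sum_congr rfl fun σ _ => ?_
  have hp : (p.1, p.2 + x - x) = p := by rw [add_sub_cancel_right]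
  rw [hp]
  ring

/-! ## §2 The diagonal direct row: rotation + moduli -/

section Diag

variable {R : RenConsts} {U : ℝ} {N : ℕ}

/-- **THE DIRECT p-h ROW AT THE DIAGONAL, IN THE ROWS DOOR'S LITERAL SHAPE.**  Under the hypotheses of `klph_phValue_row_le_of_moduli` (C4a chart for the rotation part,
`FrameOK`/`klBetaMin ≤ β ≤ L`/`j ≥ n+1` for the sign-blind mass), for any kernel product `F` and `p`-independent `V₀` with `‖F p σ p − V₀ σ‖ ≤ δ` on the hard shell:
`(Λₙ−Λₙ₊₁)((βL²)³)⁻¹·‖Σ_pΣ_σΣ_{p′}[ω-idx(p′) = ω-idx(p) ∧ p′ = p + x − x]((Φĝ)(p)(Ẇĝ)(p′) + (Ẇĝ)(p)(Φĝ)(p′))·F p σ p′‖ ≤ 2·((Λₙ−Λₙ₊₁)·‖Σ_σV₀ σ‖·𝔅₆_b(Λ(t)) + 2¹⁰·15367·δ)`.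
[cite: BenfattoGiulianiMastropietro2006, §2.4–§2.5] -/
theorem klph_directRow_diag_le_of_moduli {β μ : ℝ} {K : TrigPolyC4v} (hK : FrameOK R U N μ K) (hβ : klBetaMin ≤ β) (hβL : β ≤ L)
    {a b : ℝ} (B : BandBounds a b) {A : ℝ} (hA : ∀ p : Momentum, ∀ j ≤ 2, ‖iteratedFDeriv ℝ j (frameShift K) p‖ ≤ A) (hADt : 2 * A < B.Dtmin)
    {r : ℝ} (hlo : a < μ - r - A) (hhi : μ + r + A < b) (n : ℕ) {t : ℝ} (ht : t ∈ Icc (0 : ℝ) 1)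
    (Φ : ℕ → ℝ → FreqMomentum L M → ℝ) (hΦ : Φ = fun j t k => (softSymbolCompl L M β μ K (n + 1) j) k + (hubbardCutoffWeightCT L M β μ K (klScale klE0 (n + 1)) k -
            hubbardCutoffWeightCT L M β μ K (klScale klE0 n + t * (klScale klE0 (n + 1) - klScale klE0 n)) k))
    (Wd : ℝ → FreqMomentum L M → ℝ) (hWd : Wd = fun t k => deriv (fun Λ' : ℝ => hubbardCutoffWeightCT L M β μ K Λ' k) (klScale klE0 n + t * (klScale klE0 (n + 1) - klScale klE0 n)))
    {j : ℕ} (hj : n + 1 ≤ j) (hΛr : klScale klE0 n + t * (klScale klE0 (n + 1) - klScale klE0 n) < r)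
    (hM : β * (klScale klE0 n + t * (klScale klE0 (n + 1) - klScale klE0 n)) / (2 * Real.pi) + 1 ≤ M)
    {Mg ℓ r₁ : ℝ} (hr₁ : 0 < r₁)
    (hbd : ∀ s, |klWd (klScale klE0 n + t * (klScale klE0 (n + 1) - klScale klE0 n)) s *
      klPhi (klScale klE0 j) (klScale klE0 n + t * (klScale klE0 (n + 1) - klScale klE0 n)) s| ≤ Mg)
    (hlip : ∀ s s', |klWd (klScale klE0 n + t * (klScale klE0 (n + 1) - klScale klE0 n)) s *
        klPhi (klScale klE0 j) (klScale klE0 n + t * (klScale klE0 (n + 1) - klScale klE0 n)) s -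
      klWd (klScale klE0 n + t * (klScale klE0 (n + 1) - klScale klE0 n)) s' *
        klPhi (klScale klE0 j) (klScale klE0 n + t * (klScale klE0 (n + 1) - klScale klE0 n)) s'| ≤ ℓ * |s - s'|)
    (hin : ∀ s, s ≤ r₁ ^ 2 → klWd (klScale klE0 n + t * (klScale klE0 (n + 1) - klScale klE0 n)) s *
      klPhi (klScale klE0 j) (klScale klE0 n + t * (klScale klE0 (n + 1) - klScale klE0 n)) s = 0)
    (hout : ∀ s, (klScale klE0 n + t * (klScale klE0 (n + 1) - klScale klE0 n)) ^ 2 ≤ s →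
      klWd (klScale klE0 n + t * (klScale klE0 (n + 1) - klScale klE0 n)) s *
        klPhi (klScale klE0 j) (klScale klE0 n + t * (klScale klE0 (n + 1) - klScale klE0 n)) s = 0)
    (F : FreqMomentum L M → Fin 2 → FreqMomentum L M → ℂ) (V₀ : Fin 2 → ℂ) {δ : ℝ} (hδ0 : 0 ≤ δ)
    (hδ : ∀ p : FreqMomentum L M, ∀ σ : Fin 2, Wd t p ≠ 0 → ‖F p σ p - V₀ σ‖ ≤ δ) (c : ℤ) (x : TorusSite 2 L) :
    (klScale klE0 n - klScale klE0 (n + 1)) * ((β * (L : ℝ) ^ 2) ^ 3)⁻¹ *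
      ‖∑ p : FreqMomentum L M, ∑ σ : Fin 2, ∑ p' : FreqMomentum L M,
        (if matsubaraInt M p'.1 + c = matsubaraInt M p.1 + c ∧ p'.2 = p.2 + x - x then
          (((((Φ j t p) : ℝ) : ℂ) * (((β * (L : ℝ) ^ 2 : ℝ) : ℂ) * propCT L M β μ K p)) * ((((Wd t p') : ℝ) : ℂ) * (((β * (L : ℝ) ^ 2 : ℝ) : ℂ) * propCT L M β μ K p')) +
            ((((Wd t p) : ℝ) : ℂ) * (((β * (L : ℝ) ^ 2 : ℝ) : ℂ) * propCT L M β μ K p)) * ((((Φ j t p') : ℝ) : ℂ) * (((β * (L : ℝ) ^ 2 : ℝ) : ℂ) * propCT L M β μ K p'))) *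
            F p σ p'
        else 0)‖ ≤
      2 * ((klScale klE0 n - klScale klE0 (n + 1)) * ‖∑ σ : Fin 2, V₀ σ‖ *
        (((2 * π) ^ 2)⁻¹ * (2 * π * (π * Real.sqrt 2 / (B.Dtmin - 2 * A)) *
              ((2 * (klScale klE0 n + t * (klScale klE0 (n + 1) - klScale klE0 n)) * (2 * (klScale klE0 n + t * (klScale klE0 (n + 1) - klScale klE0 n)) *
                (2 * (klScale klE0 n + t * (klScale klE0 (n + 1) - klScale klE0 n)) ^ 2 * (ℓ / r₁ ^ 4 + 2 * Mg / r₁ ^ 6) + (ℓ / r₁ ^ 2 + Mg / r₁ ^ 4)))) *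
                ((klScale klE0 n + t * (klScale klE0 (n + 1) - klScale klE0 n)) + 2 * Real.pi / β) / β) +
            β⁻¹ * (((klScale klE0 n + t * (klScale klE0 (n + 1) - klScale klE0 n)) * β / π + 1) *
              (2 * (klScale klE0 n + t * (klScale klE0 (n + 1) - klScale klE0 n)) *
                (2 * π * (1 / (B.Dtmin - 2 * A) ^ 2 + Real.pi * Real.sqrt 2 * (2 + 4 * A) / (B.Dtmin - 2 * A) ^ 3) *
                  (klScale klE0 n + t * (klScale klE0 (n + 1) - klScale klE0 n)) * (Mg / r₁ ^ 2))))) +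
          ((klScale klE0 n + t * (klScale klE0 (n + 1) - klScale klE0 n)) / π + 3 / β) *
            (2 * π * (2 * (klScale klE0 n + t * (klScale klE0 (n + 1) - klScale klE0 n)) *
              (2 * (klScale klE0 n + t * (klScale klE0 (n + 1) - klScale klE0 n)) ^ 2 * (ℓ / r₁ ^ 4 + 2 * Mg / r₁ ^ 6) + (ℓ / r₁ ^ 2 + Mg / r₁ ^ 4)) *
              (4 + 2 * A)) / L)) +
        (2 : ℝ) ^ 10 * 15367 * δ) := by
  have h10 := (klmf_klScale_succ_pos_le n).2
  have hdiff : 0 ≤ klScale klE0 n - klScale klE0 (n + 1) := by linarith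
  have hmod := klph_phValue_row_le_of_moduli (L := L) (M := M) hK hβ hβL B hA hADt hlo hhi n ht Φ hΦ Wd hWd hj hΛr hM hr₁ hbd hlip hin hout
    (fun p σ => F p σ p) V₀ hδ0 hδ
  rw [klph_directRow_diag_eq β μ K (Φ j t) (Wd t) F c x, norm_mul, Complex.norm_ofNat]
  have hre : (klScale klE0 n - klScale klE0 (n + 1)) * ((β * (L : ℝ) ^ 2) ^ 3)⁻¹ *
        (2 * ‖∑ p : FreqMomentum L M, ∑ σ : Fin 2,
          (((((Wd t p) : ℝ) : ℂ) * (((β * (L : ℝ) ^ 2 : ℝ) : ℂ) * propCT L M β μ K p)) * ((((Φ j t p) : ℝ) : ℂ) * (((β * (L : ℝ) ^ 2 : ℝ) : ℂ) * propCT L M β μ K p))) *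
            F p σ p‖) =
      2 * ((klScale klE0 n - klScale klE0 (n + 1)) * ((β * (L : ℝ) ^ 2) ^ 3)⁻¹ *
        ‖∑ p : FreqMomentum L M, ∑ σ : Fin 2,
          (((((Wd t p) : ℝ) : ℂ) * (((β * (L : ℝ) ^ 2 : ℝ) : ℂ) * propCT L M β μ K p)) * ((((Φ j t p) : ℝ) : ℂ) * (((β * (L : ℝ) ^ 2 : ℝ) : ℂ) * propCT L M β μ K p))) *
            F p σ p‖) := by ring
  rw [hre]
  linarith

end Diag

end Summit.HubbardSuperconductivity.HubbardSuperconductivity.Theorems.KLRegimeSplit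

end
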